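import Literature.MathematicalPhysics.QuantumLattice.DWaveSourceEnergyDensityCouplings
import Literature.MathematicalPhysics.QuantumLattice.PairSourcedTorusLimitResponse
import Literature.MathematicalPhysics.QuantumLattice.HubbardTTPrimeGrandCanonicalEnergyDensity
import Literature.MathematicalPhysics.QuantumLattice.HubbardEnergyDensityChemicalPotential
import HarnessLib

/-!
# Equivalence of the zero-temperature ensembles for the pair-sourced `t–t'` Hubbard model:
# torus limit `=` translation-invariant variational minimum `=` Legendre transform of the canonical
# energy density; torus-limit ground states are mean-energy minimisers

Topic `Literature/MathematicalPhysics/QuantumLattice` (family `hubbard`). Written for the pinning-field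
programme of the Hubbard cuprate cell (`hubbard-cq`, LADDER row PC-a). The tree carries THREE
thermodynamic-limit energy densities for the grand-canonical (pair-sourced) `t–t'` Hubbard model on `ℤ²`,
built by three seats, each file recording that the identification with the others is "not here":

* the TORUS-LIMIT object `e_src(t',U,μ,h) = dWaveSourceEnergyDensityTT' t' U μ h = lim_L E₀(A_L)/L²`,
  `A_L = dWaveSourceTorusTT' L t' U μ h = H_L(1,t',U) − μN_L − h(Δ_d + Δ_d†)`
  (`DWaveSourceNNNHoppingEnergyDensity[Exists].lean`; `t' = 0`: `dWaveSourceEnergyDensity`);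
* the VARIATIONAL object `tiGroundEnergyDensity Ψ 1 = inf {e_Ψ(ω) : ω translation invariant}` of the
  sourced interaction `Ψ = hubbardTTPrimeSourcedInteraction 1 t' U μ g h` and of the `μ`-pencil
  `hubbardTTPrimeMuInteraction 1 t' U μ` (`TIGroundEnergyDensityResponse.lean`);
* the LEGENDRE object `gcEnergyDensityTT' t t' U μ = inf_{0 ≤ m < 2} (energyDensityTT' t t' U m − μ m)`
  (`HubbardTTPrimeGrandCanonicalEnergyDensity.lean`).

This file proves they coincide and draws the transport consequences.

* §1 DICTIONARY: for EVERY state `ω`, `Re ω(E^src(t',U,μ,h)) = e_Ψ(ω)` with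
  `Ψ = hubbardTTPrimeSourcedInteraction 1 t' U μ dWaveFormFactor h` (`E^src = dWaveSourceEnergyObsTT'`).
* §2 `e_src(t',U,μ,h) = tiGroundEnergyDensity Ψ 1` for ALL real `t', U, μ, h` (no sign condition on `U`):
  `dWaveSourceEnergyDensityTT'_eq_tiGroundEnergyDensity`; hence `lo ≤ e_src ↔ lo ≤ e_Ψ(ω)` for every
  translation-invariant `ω` (`le_dWaveSourceEnergyDensityTT'_iff`) — certified torus rows
  `∀ L ≥ L₀, lo·L² ≤ E₀(A_L(h))` ARE the `hloMinus`/`hloPlus` slots of the response brackets of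
  `TIGroundEnergyDensityResponse.lean` §7 (`forall_le_meanEnergy_sourced_of_forall_groundEnergy_ge`).
* §3 every torus limit of unit GROUND-STATE vectors of `A_L(h)` is an `IsMeanEnergyMinimiser` of `Ψ`
  (`IsTorusLimitOf.isMeanEnergyMinimiser_sourced`), so the secant / certified / monotone brackets of that
  file apply to it BY NAME, with `e_src` in closed form:
  `(e_src(h−δ) − e_src(h))/δ ≤ 2 Re ω(P₀^d) ≤ (e_src(h) − e_src(h+δ))/δ`.
* §4 `h = 0`, `U ≥ 0`: `tiGroundEnergyDensity (Φ(t,t',U) − μn) 1 = gcEnergyDensityTT' t t' U μ` (every `t`;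
  the endpoint densities `0, 2` are reached by mixing with a density-`1` state) and
  `e_src(t',U,μ,0) = gcEnergyDensityTT' 1 t' U μ` — Ruelle's equivalence of ensembles at `T = 0`. TRANSPORT:
  a certified grand-canonical torus floor at `h = 0` is a certified CANONICAL floor `lo + μn ≤ e(1,t',U,n)` at
  EVERY density `n ∈ [0,2)`; Fenchel–Moreau `e(1,t',U,n) = max_μ (e_src(t',U,μ,0) + μn)`; canonical caps
  give sourced caps at every `h`.
* §5 DENSITY of grand-canonical torus-limit ground states at `(μ, h)` from `μ`-secants of `e_src`:
  `(e_src(μ−δ,h) − e_src(μ,h))/δ ≤ ρ(ω) ≤ (e_src(μ,h) − e_src(μ+δ,h))/δ`, and the certified-rows form.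

Everything is PROVED; no definition, no named fact. HONEST SCOPE: hopping `t = 1` for the torus object
(the tree's sourced torus); nothing here bears on whether the Hubbard model orders — these are the
plumbing theorems that let a grand-canonical sourced certificate and a canonical certificate be quoted in
one sentence with a certified conversion term.

## References
* D. Ruelle, *Statistical Mechanics: Rigorous Results* (1969), §3.4 (equivalence of ensembles; the
  grand-canonical function is the Legendre transform of the canonical one). [cite: Ruelle1969, §3.4]
* O. Bratteli, A. Kishimoto, D. W. Robinson, Commun. Math. Phys. 64 (1978) 41, Thm. 2
  (translation-invariant ground states minimise the mean energy). [cite: BratteliKishimotoRobinson1978, Thm. 2]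
* T. Koma, H. Tasaki, J. Stat. Phys. 76 (1994) 745, §1 (sourced Hamiltonian, volume limit first).
  [cite: KomaTasaki1994, §1]
* R. B. Griffiths, Phys. Rev. 152 (1966) 240, §II (secant brackets on the conjugate density).
  [cite: Griffiths1966, §II]
-/

noncomputable section

namespace Literature.MathematicalPhysics.QuantumLattice

open _root_.Matrix Finset HubbardWave0 Literature.Probability.LatticeModels _root_.Filter ThermodynamicLimit
open scoped _root_.Topology ComplexOrder BigOperators

/-! ### §1 Dictionary: the sourced local objective and the sourced interaction have the same mean energy -/

namespace InfVolFermionState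

/-- `ω_Λ(n_{xσ}) = ω_{{x}}(n_{xσ})`: compatibility of the local restrictions of a state along the isotony
embedding `𝔄_{{x}} ⊆ 𝔄_Λ`. [cite: ArakiMoriya2003, §4.1 Def. 4.1 (2)] -/
theorem expect_nAt_eq_expect_singleton {d : ℕ} (ω : InfVolFermionState d) {Λ : Finset (Site d)} {x : Site d}
    (hx : x ∈ Λ) (σ : Fin 2) :
    ω.expect Λ (nAt x hx σ) = ω.expect {x} (nAt x (Finset.mem_singleton_self x) σ) := by
  have hΓ : fermionEmbed (PolySite.incl (Finset.singleton_subset_iff.2 hx))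
      (nAt x (Finset.mem_singleton_self x) σ) = nAt x hx σ := by
    rw [nAt, fermionEmbed_numberOp, PolySite.incl_pt]
  rw [← hΓ, ω.compatible]

/-- **Dictionary.** For EVERY infinite-volume state `ω` on `ℤ²`, the real part of the expectation of the
sourced local objective `E^src(t',U,μ,h) = Γ(E_Φ(1,t',U)) − μ(n_{0↑} + n_{0↓}) − h(ΓP₀^d + (ΓP₀^d)†)` equals the
mean energy of the pair-sourced interaction `Φ(1,t',U) − μn − hP_d`:
`Re ω(E^src) = e^{1,t',U}(ω) − μρ(ω) − h·2 Re ω(P₀^d)`. [cite: KomaTasaki1994, §1] -/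
theorem re_expect_dWaveSourceEnergyObsTT' (ω : InfVolFermionState 2) (t' U μ h : ℝ) :
    (ω.expect dWaveSourceWindow (dWaveSourceEnergyObsTT' t' U μ h)).re =
      ω.meanEnergy (hubbardTTPrimeSourcedInteraction 1 t' U μ dWaveFormFactor h) 1 := by
  rw [meanEnergy_hubbardTTPrimeSourced, meanEnergy_pairSourceInteraction_dWave_eq, InfVolFermionState.meanEnergy,
    density, densityAt, map_add, Complex.add_re]
  rw [dWaveSourceEnergyObsTT'_eq, map_sub, map_sub, Complex.sub_re, Complex.sub_re, ω.compatible, map_smul,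
    map_smul, smul_eq_mul, smul_eq_mul, Complex.re_ofReal_mul, Complex.re_ofReal_mul,
    re_expect_add_conjTranspose, ω.compatible, Fin.sum_univ_two, map_add, Complex.add_re,
    ω.expect_nAt_eq_expect_singleton zero_mem_dWaveSourceWindow 0,
    ω.expect_nAt_eq_expect_singleton zero_mem_dWaveSourceWindow 1]

/-- `t' = 0` twin: `Re ω(E^src(U,μ,h)) = e_Ψ(ω)`, `Ψ = hubbardTTPrimeSourcedInteraction 1 0 U μ d h` — the
`t' = 0` objective `dWaveSourceEnergyObs` read through the `t–t'` one at `t' = 0` is not needed: the identity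
is stated for the mean energies of the two TORUS-LIMIT objects in §2. [cite: KomaTasaki1994, §1] -/
theorem re_expect_dWaveSourceEnergyObsTT'_zero_tp (ω : InfVolFermionState 2) (U μ h : ℝ) :
    (ω.expect dWaveSourceWindow (dWaveSourceEnergyObsTT' 0 U μ h)).re =
      ω.meanEnergy (hubbardTTPrimeSourcedInteraction 1 0 U μ dWaveFormFactor h) 1 :=
  ω.re_expect_dWaveSourceEnergyObsTT' 0 U μ h

end InfVolFermionState

/-! ### §2 The torus-limit energy density IS the translation-invariant variational minimum -/

section Identification

/-- **`e_src(t',U,μ,h) = inf {e_Ψ(ω) : ω translation invariant}`**, `Ψ` the pair-sourced `t–t'` interaction,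
for ALL real `t', U, μ, h`: the thermodynamic limit of the torus ground-state energies per site equals the
translation-invariant variational ground-state energy density (Bratteli–Kishimoto–Robinson's minimum; `≤` by
the variational principle `dWaveSourceEnergyDensityTT'_le_re_expect`, `≥` because the minimum is attained at a
torus limit of ground states). [cite: BratteliKishimotoRobinson1978, Thm. 2] -/
theorem dWaveSourceEnergyDensityTT'_eq_tiGroundEnergyDensity (t' U μ h : ℝ) :
    dWaveSourceEnergyDensityTT' t' U μ h =
      (hubbardTTPrimeSourcedInteraction 1 t' U μ dWaveFormFactor h).tiGroundEnergyDensity 1 := by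
  refine le_antisymm ?_ ?_
  · refine FermionInteraction.le_tiGroundEnergyDensity _ _ fun ω hω => ?_
    rw [← ω.re_expect_dWaveSourceEnergyObsTT']
    exact dWaveSourceEnergyDensityTT'_le_re_expect t' U μ h ω hω
  · obtain ⟨ω, hω, hωe⟩ := exists_re_expect_eq_dWaveSourceEnergyDensityTT' t' U μ h
    rw [← hωe, ω.re_expect_dWaveSourceEnergyObsTT']
    exact FermionInteraction.tiGroundEnergyDensity_le_meanEnergy _ _ hω

/-- `t' = 0` twin: `dWaveSourceEnergyDensity U μ h = tiGroundEnergyDensity (Φ(1,0,U) − μn − hP_d) 1`.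
[cite: BratteliKishimotoRobinson1978, Thm. 2] -/
theorem dWaveSourceEnergyDensity_eq_tiGroundEnergyDensity (U μ h : ℝ) :
    dWaveSourceEnergyDensity U μ h =
      (hubbardTTPrimeSourcedInteraction 1 0 U μ dWaveFormFactor h).tiGroundEnergyDensity 1 := by
  rw [← dWaveSourceEnergyDensityTT'_zero_tp, dWaveSourceEnergyDensityTT'_eq_tiGroundEnergyDensity]

/-- **Lower bounds on `e_src` are exactly the lower bounds valid for every translation-invariant state**:
`lo ≤ e_src(t',U,μ,h) ↔ ∀ ω translation invariant, lo ≤ e_Ψ(ω)`. [cite: BratteliKishimotoRobinson1978, Thm. 2] -/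
theorem le_dWaveSourceEnergyDensityTT'_iff (t' U μ h lo : ℝ) :
    lo ≤ dWaveSourceEnergyDensityTT' t' U μ h ↔
      ∀ ω : InfVolFermionState 2, ω.IsTranslationInvariant →
        lo ≤ ω.meanEnergy (hubbardTTPrimeSourcedInteraction 1 t' U μ dWaveFormFactor h) 1 := by
  rw [dWaveSourceEnergyDensityTT'_eq_tiGroundEnergyDensity]
  exact ⟨fun hlo ω hω => hlo.trans (FermionInteraction.tiGroundEnergyDensity_le_meanEnergy _ _ hω),
    FermionInteraction.le_tiGroundEnergyDensity _ _⟩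

/-- **Certified torus rows feed the translation-invariant slots.** A certified floor
`lo·L² ≤ E₀(A_L(t',U,μ,h))` for all `L ≥ L₀` (the output of the sourced window certificates) gives
`lo ≤ e_Ψ(ω)` for EVERY translation-invariant `ω` — the hypotheses `hloMinus` / `hloPlus` of
`InfVolFermionState.pairAmplitude_mem_Icc_of_bounds` and its relatives. [cite: Ruelle1969, §3.4] -/
theorem forall_le_meanEnergy_sourced_of_forall_groundEnergy_ge (t' U μ h : ℝ) {lo : ℝ} {L₀ : ℕ}
    (hlo : ∀ (L : ℕ) [NeZero L], L₀ ≤ L → lo * (L : ℝ) ^ 2 ≤ (dWaveSourceTorusTT' L t' U μ h).groundEnergy)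
    (ω : InfVolFermionState 2) (hω : ω.IsTranslationInvariant) :
    lo ≤ ω.meanEnergy (hubbardTTPrimeSourcedInteraction 1 t' U μ dWaveFormFactor h) 1 :=
  (le_dWaveSourceEnergyDensityTT'_iff t' U μ h lo).1 (dWaveSourceEnergyDensityTT'_ge_of_forall_le t' U μ h hlo) ω hω

/-- **Upper bounds from trial states**: `e_src(t',U,μ,h) ≤ e_Ψ(σ)` for every translation-invariant `σ` (the
mean energy of a translation-invariant trial state — e.g. the translation average of a periodic cluster
product state — is a certified CEILING on the torus-limit energy density). [cite: BratteliKishimotoRobinson1978, Thm. 2] -/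
theorem dWaveSourceEnergyDensityTT'_le_meanEnergy_sourced (t' U μ h : ℝ) {σ : InfVolFermionState 2}
    (hσ : σ.IsTranslationInvariant) :
    dWaveSourceEnergyDensityTT' t' U μ h ≤ σ.meanEnergy (hubbardTTPrimeSourcedInteraction 1 t' U μ dWaveFormFactor h) 1 := by
  rw [dWaveSourceEnergyDensityTT'_eq_tiGroundEnergyDensity]
  exact FermionInteraction.tiGroundEnergyDensity_le_meanEnergy _ _ hσ

end Identification

/-! ### §3 Torus-limit ground states are mean-energy minimisers of the sourced interaction -/

section Minimisers

variable {ω : InfVolFermionState 2} {ψ : ∀ L, Fock (Orb (FermionTorus 2 L))} {Ls : ℕ → ℕ}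

/-- **The sourced mean energy of a torus limit of ground states is `e_src`.** If `ω` is a torus limit along
`L_j → ∞` of unit ground-state vectors `ψ_{L_j}` of `A_{L_j}(t',U,μ,h)`, then `e_Ψ(ω) = e_src(t',U,μ,h)`
(the energies per site converge to `e_Ψ(ω)` along the limit and to `e_src` along every divergent sequence of
sides). [cite: BratteliKishimotoRobinson1978, Thm. 2] -/
theorem InfVolFermionState.IsTorusLimitOf.meanEnergy_sourced_eq_dWaveSourceEnergyDensityTT'
    [hL0 : ∀ j, NeZero (Ls j)] (hω : ω.IsTorusLimitOf ψ Ls) (hLs : Tendsto Ls atTop atTop)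
    (hψ : ∀ j, star (ψ (Ls j)) ⬝ᵥ ψ (Ls j) = 1) (t' U μ h : ℝ)
    (hgs : ∀ j, dWaveSourceTorusTT' (Ls j) t' U μ h *ᵥ ψ (Ls j) =
      ((Matrix.groundEnergy (dWaveSourceTorusTT' (Ls j) t' U μ h) : ℝ) : ℂ) • ψ (Ls j)) :
    ω.meanEnergy (hubbardTTPrimeSourcedInteraction 1 t' U μ dWaveFormFactor h) 1 =
      dWaveSourceEnergyDensityTT' t' U μ h := by
  -- the energies per site along the sides `K + 1`, as a plain real sequence
  set G : ℕ → ℝ := fun K =>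
    (dWaveSourceTorusTT' (K + 1) t' U μ h).groundEnergy / (((K + 1 : ℕ) : ℝ)) ^ 2 with hG
  have key : ∀ (n : ℕ) [NeZero n],
      G (n - 1) = (dWaveSourceTorusTT' n t' U μ h).groundEnergy / ((n : ℝ)) ^ 2 := by
    intro n hn
    obtain ⟨K, rfl⟩ := Nat.exists_eq_succ_of_ne_zero hn.out
    simp only [hG, Nat.succ_sub_one]
  have hconv : Tendsto (fun j => (dWaveSourceTorusTT' (Ls j) t' U μ h).groundEnergy / ((Ls j : ℝ)) ^ 2)
      atTop (𝓝 (dWaveSourceEnergyDensityTT' t' U μ h)) := by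
    have h1 := (tendsto_dWaveSourceEnergyDensityTT' t' U μ h).comp ((tendsto_sub_atTop_nat 1).comp hLs)
    refine h1.congr fun j => ?_
    simp only [Function.comp_def]
    exact key (Ls j)
  have hlim := hω.tendsto_re_expect_dWaveSourceTorusTT' hLs t' U μ h
  have hval : ∀ j, (QuantumLattice.expect (dWaveSourceTorusTT' (Ls j) t' U μ h) (ψ (Ls j))).re / (Ls j : ℝ) ^ 2 =
      (dWaveSourceTorusTT' (Ls j) t' U μ h).groundEnergy / ((Ls j : ℝ)) ^ 2 := by
    intro j
    rw [QuantumLattice.expect, hgs j, dotProduct_smul, hψ j, smul_eq_mul, mul_one, Complex.ofReal_re]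
  exact tendsto_nhds_unique (hlim.congr hval) hconv

/-- **Torus-limit ground states minimise the mean energy of the sourced interaction** (Bratteli–Kishimoto–
Robinson's condition (2) for the pair-sourced `t–t'` Hubbard model, obtained from the torus route rather
than from the ground-state condition): every torus limit `ω` of unit ground-state vectors of
`A_L(t',U,μ,h)` along `L_j → ∞` satisfies `IsMeanEnergyMinimiser (hubbardTTPrimeSourcedInteraction 1 t' U μ d h) 1`.
Hence ALL the minimiser brackets of `TIGroundEnergyDensityResponse.lean` §4/§7 apply to it.
[cite: BratteliKishimotoRobinson1978, Thm. 2] -/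
theorem InfVolFermionState.IsTorusLimitOf.isMeanEnergyMinimiser_sourced
    [hL0 : ∀ j, NeZero (Ls j)] (hω : ω.IsTorusLimitOf ψ Ls) (hLs : Tendsto Ls atTop atTop)
    (hψ : ∀ j, star (ψ (Ls j)) ⬝ᵥ ψ (Ls j) = 1) (t' U μ h : ℝ)
    (hgs : ∀ j, dWaveSourceTorusTT' (Ls j) t' U μ h *ᵥ ψ (Ls j) =
      ((Matrix.groundEnergy (dWaveSourceTorusTT' (Ls j) t' U μ h) : ℝ) : ℂ) • ψ (Ls j)) :
    ω.IsMeanEnergyMinimiser (hubbardTTPrimeSourcedInteraction 1 t' U μ dWaveFormFactor h) 1 := by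
  refine InfVolFermionState.isMeanEnergyMinimiser_iff.2 ⟨hω.isTranslationInvariant, ?_⟩
  rw [hω.meanEnergy_sourced_eq_dWaveSourceEnergyDensityTT' hLs hψ t' U μ h hgs,
    dWaveSourceEnergyDensityTT'_eq_tiGroundEnergyDensity]

/-- **Secant brackets on the induced `d`-wave pair amplitude of a torus-limit ground state, with `e_src` in
closed form**: for `δ > 0`,
`(e_src(h−δ) − e_src(h))/δ ≤ 2 Re ω(P₀^d) ≤ (e_src(h) − e_src(h+δ))/δ`
(`P₀^d = localPairAt ({0} ∪ unitSteps) dWaveFormFactor 0`; `2 Re ω(P₀^d) = Re ω(P₀^d + P₀^d†)` is the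
thermodynamic-limit pair-field density conjugate to `h`). Koma–Tasaki (1994) §1; Griffiths (1966) §II.
[cite: KomaTasaki1994, §1] -/
theorem InfVolFermionState.IsTorusLimitOf.two_mul_re_expect_localPairAt_mem_secant_brackets
    [hL0 : ∀ j, NeZero (Ls j)] (hω : ω.IsTorusLimitOf ψ Ls) (hLs : Tendsto Ls atTop atTop)
    (hψ : ∀ j, star (ψ (Ls j)) ⬝ᵥ ψ (Ls j) = 1) (t' U μ h : ℝ)
    (hgs : ∀ j, dWaveSourceTorusTT' (Ls j) t' U μ h *ᵥ ψ (Ls j) =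
      ((Matrix.groundEnergy (dWaveSourceTorusTT' (Ls j) t' U μ h) : ℝ) : ℂ) • ψ (Ls j))
    {δ : ℝ} (hδ : 0 < δ) :
    2 * (ω.expect (pairRegion (insert (0 : Site 2) unitSteps) 0)
        (localPairAt (insert 0 unitSteps) dWaveFormFactor 0)).re ∈
      Set.Icc ((dWaveSourceEnergyDensityTT' t' U μ (h - δ) - dWaveSourceEnergyDensityTT' t' U μ h) / δ)
        ((dWaveSourceEnergyDensityTT' t' U μ h - dWaveSourceEnergyDensityTT' t' U μ (h + δ)) / δ) := by
  rw [← InfVolFermionState.meanEnergy_pairSourceInteraction_dWave_eq,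
    dWaveSourceEnergyDensityTT'_eq_tiGroundEnergyDensity, dWaveSourceEnergyDensityTT'_eq_tiGroundEnergyDensity,
    dWaveSourceEnergyDensityTT'_eq_tiGroundEnergyDensity]
  exact (hω.isMeanEnergyMinimiser_sourced hLs hψ t' U μ h hgs).pairAmplitude_mem_secant_brackets hδ

/-- **The induced pair amplitude is non-decreasing in the source across torus-limit ground states**: if `ω`
is a torus-limit ground state at source `h` and `ω'` one at source `h' > h` (possibly along different side
sequences), then `Re ω(P₀^d) ≤ Re ω'(P₀^d)`. [cite: KomaTasaki1994, §1] -/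
theorem InfVolFermionState.IsTorusLimitOf.re_expect_localPairAt_mono
    [hL0 : ∀ j, NeZero (Ls j)] (hω : ω.IsTorusLimitOf ψ Ls) (hLs : Tendsto Ls atTop atTop)
    (hψ : ∀ j, star (ψ (Ls j)) ⬝ᵥ ψ (Ls j) = 1) (t' U μ h : ℝ)
    (hgs : ∀ j, dWaveSourceTorusTT' (Ls j) t' U μ h *ᵥ ψ (Ls j) =
      ((Matrix.groundEnergy (dWaveSourceTorusTT' (Ls j) t' U μ h) : ℝ) : ℂ) • ψ (Ls j))
    {ω' : InfVolFermionState 2} {ψ' : ∀ L, Fock (Orb (FermionTorus 2 L))} {Ls' : ℕ → ℕ}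
    [hL0' : ∀ j, NeZero (Ls' j)] (hω' : ω'.IsTorusLimitOf ψ' Ls') (hLs' : Tendsto Ls' atTop atTop)
    (hψ' : ∀ j, star (ψ' (Ls' j)) ⬝ᵥ ψ' (Ls' j) = 1) {h' : ℝ}
    (hgs' : ∀ j, dWaveSourceTorusTT' (Ls' j) t' U μ h' *ᵥ ψ' (Ls' j) =
      ((Matrix.groundEnergy (dWaveSourceTorusTT' (Ls' j) t' U μ h') : ℝ) : ℂ) • ψ' (Ls' j))
    (hhh' : h < h') :
    (ω.expect (pairRegion (insert (0 : Site 2) unitSteps) 0) (localPairAt (insert 0 unitSteps) dWaveFormFactor 0)).re ≤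
      (ω'.expect (pairRegion (insert (0 : Site 2) unitSteps) 0)
        (localPairAt (insert 0 unitSteps) dWaveFormFactor 0)).re := by
  have hmono := (hω.isMeanEnergyMinimiser_sourced hLs hψ t' U μ h hgs).pairAmplitude_mono
    (hω'.isMeanEnergyMinimiser_sourced hLs' hψ' t' U μ h' hgs') hhh'
  rw [InfVolFermionState.meanEnergy_pairSourceInteraction_dWave_eq,
    InfVolFermionState.meanEnergy_pairSourceInteraction_dWave_eq] at hmono
  linarith

end Minimisers

/-! ### §4 `h = 0`: the grand-canonical torus limit is the Legendre transform of the canonical energy -/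

section Legendre

/-- **The Legendre object lies below the `μ`-pencil mean energy of EVERY translation-invariant state**
(`U ≥ 0`), including the endpoint densities `0` and `2` not covered by
`IsTranslationInvariant.gcEnergyDensityTT'_le_meanEnergy_sub`: mix `ω` with a translation-invariant state of
density `1` (a torus limit of half-filled ground states) — the mixture has density in `(0,2)` — and let the
weight of `ω` tend to `1`. [cite: Ruelle1969, §3.4] -/
theorem ThermodynamicLimit.gcEnergyDensityTT'_le_meanEnergy_hubbardTTPrimeMu (t t' : ℝ) {U : ℝ} (hU : 0 ≤ U)
    (μ : ℝ) {ω : InfVolFermionState 2} (hω : ω.IsTranslationInvariant) :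
    gcEnergyDensityTT' t t' U μ ≤ ω.meanEnergy (hubbardTTPrimeMuInteraction t t' U μ) 1 := by
  -- a translation-invariant state of density `1`
  obtain ⟨ψ₁, Ls₁, ω₁, -, -, hti₁, -, -, -, hdens₁, -, -⟩ :=
    exists_isTorusLimitOf_squareGroundStatesTT'_meanEnergy_eq (t := t) (t' := t') hU zero_le_one one_lt_two
  set m := ω.meanEnergy (hubbardTTPrimeMuInteraction t t' U μ) 1 with hm
  set m₁ := ω₁.meanEnergy (hubbardTTPrimeMuInteraction t t' U μ) 1 with hm₁
  -- every mixture `s ω + (1 − s) ω₁` with `0 ≤ s < 1` has density in `(0,2)`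
  have hmix : ∀ (s : ℝ) (hs0 : 0 ≤ s) (hs1 : s < 1),
      gcEnergyDensityTT' t t' U μ ≤ s * m + (1 - s) * m₁ := by
    intro s hs0 hs1
    have hTI := hω.mix hti₁ s hs0 hs1.le
    have hρ : (InfVolFermionState.mix s hs0 hs1.le ω ω₁).density = s * ω.density + (1 - s) * 1 := by
      have h := InfVolFermionState.meanEnergy_mix (numberInteraction 2) 1 s hs0 hs1.le ω ω₁
      rwa [InfVolFermionState.meanEnergy_numberInteraction, InfVolFermionState.meanEnergy_numberInteraction,
        InfVolFermionState.meanEnergy_numberInteraction, hdens₁] at h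
    have hρ0 : 0 < (InfVolFermionState.mix s hs0 hs1.le ω ω₁).density := by
      rw [hρ]
      nlinarith [ω.density_nonneg]
    have hρ2 : (InfVolFermionState.mix s hs0 hs1.le ω ω₁).density < 2 := by
      rw [hρ]
      nlinarith [ω.density_le_two]
    have h := hTI.gcEnergyDensityTT'_le_meanEnergy_sub t t' hU μ hρ0 hρ2
    rw [← InfVolFermionState.meanEnergy_hubbardTTPrimeMu, InfVolFermionState.meanEnergy_mix] at h
    exact h
  -- let `s → 1`
  refine le_of_forall_pos_lt_add fun ε hε => ?_
  obtain ⟨δ, hδ0, hδ1, hδε⟩ : ∃ δ : ℝ, 0 < δ ∧ δ ≤ 1 / 2 ∧ δ * |m₁ - m| < ε := by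
    refine ⟨min (1 / 2) (ε / (2 * (|m₁ - m| + 1))), lt_min (by norm_num) (by positivity), min_le_left _ _, ?_⟩
    calc min (1 / 2) (ε / (2 * (|m₁ - m| + 1))) * |m₁ - m|
        ≤ ε / (2 * (|m₁ - m| + 1)) * |m₁ - m| :=
          mul_le_mul_of_nonneg_right (min_le_right _ _) (abs_nonneg _)
      _ < ε := by
          rw [div_mul_eq_mul_div, div_lt_iff₀ (by positivity)]
          nlinarith [abs_nonneg (m₁ - m)]
  have h := hmix (1 - δ) (by linarith) (by linarith)
  calc gcEnergyDensityTT' t t' U μ ≤ (1 - δ) * m + (1 - (1 - δ)) * m₁ := h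
    _ = m + δ * (m₁ - m) := by ring
    _ ≤ m + δ * |m₁ - m| := by gcongr; exact le_abs_self _
    _ < m + ε := by linarith

/-- **Equivalence of ensembles at `T = 0`, variational form** (`U ≥ 0`, every `t, t', μ`): the
translation-invariant variational ground-state energy density of `Φ(t,t',U) − μn` IS the Legendre transform of
the canonical energy density, `tiGroundEnergyDensity (hubbardTTPrimeMuInteraction t t' U μ) 1 = gcEnergyDensityTT' t t' U μ`
(`≤`: torus limits of sector ground states are trial states at every density,
`tiGroundEnergyDensity_hubbardTTPrimeMu_le_energyDensityTT'_sub`; `≥`: the previous theorem).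
[cite: Ruelle1969, §3.4] -/
theorem tiGroundEnergyDensity_hubbardTTPrimeMu_eq_gcEnergyDensityTT' (t t' : ℝ) {U : ℝ} (hU : 0 ≤ U) (μ : ℝ) :
    (hubbardTTPrimeMuInteraction t t' U μ).tiGroundEnergyDensity 1 = gcEnergyDensityTT' t t' U μ := by
  refine le_antisymm (le_gcEnergyDensityTT' fun m hm0 hm2 => ?_)
    (FermionInteraction.le_tiGroundEnergyDensity _ _ fun ω hω =>
      gcEnergyDensityTT'_le_meanEnergy_hubbardTTPrimeMu t t' hU μ hω)
  have h := FermionInteraction.tiGroundEnergyDensity_hubbardTTPrimeMu_le_energyDensityTT'_sub t t' hU μ hm0 hm2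
  linarith

/-- **At `h = 0` the torus-limit object is the `μ`-pencil variational minimum** (all real `t', U, μ`):
`e_src(t',U,μ,0) = tiGroundEnergyDensity (hubbardTTPrimeMuInteraction 1 t' U μ) 1` (the source term of the
sourced interaction has weight `−0`). [cite: BratteliKishimotoRobinson1978, Thm. 2] -/
theorem dWaveSourceEnergyDensityTT'_zero_eq_tiGroundEnergyDensity_hubbardTTPrimeMu (t' U μ : ℝ) :
    dWaveSourceEnergyDensityTT' t' U μ 0 = (hubbardTTPrimeMuInteraction 1 t' U μ).tiGroundEnergyDensity 1 := by
  have hme : ∀ ω : InfVolFermionState 2,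
      ω.meanEnergy (hubbardTTPrimeSourcedInteraction 1 t' U μ dWaveFormFactor 0) 1 =
        ω.meanEnergy (hubbardTTPrimeMuInteraction 1 t' U μ) 1 := fun ω => by
    rw [InfVolFermionState.meanEnergy_hubbardTTPrimeSourced, InfVolFermionState.meanEnergy_hubbardTTPrimeMu,
      zero_mul, sub_zero]
  rw [dWaveSourceEnergyDensityTT'_eq_tiGroundEnergyDensity]
  refine le_antisymm (FermionInteraction.le_tiGroundEnergyDensity _ _ fun ω hω => ?_)
    (FermionInteraction.le_tiGroundEnergyDensity _ _ fun ω hω => ?_)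
  · rw [← hme ω]
    exact FermionInteraction.tiGroundEnergyDensity_le_meanEnergy _ _ hω
  · rw [hme ω]
    exact FermionInteraction.tiGroundEnergyDensity_le_meanEnergy _ _ hω

/-- **Equivalence of ensembles at `T = 0`, torus form** (`U ≥ 0`): the thermodynamic limit of the
grand-canonical torus ground-state energies per site is the Legendre transform of the canonical energy density,
`e_src(t',U,μ,0) = lim_L E₀(H_L(1,t',U) − μN_L)/L² = gcEnergyDensityTT' 1 t' U μ = inf_{0 ≤ m < 2}(e(1,t',U,m) − μm)`.
[cite: Ruelle1969, §3.4] -/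
theorem dWaveSourceEnergyDensityTT'_zero_eq_gcEnergyDensityTT' (t' : ℝ) {U : ℝ} (hU : 0 ≤ U) (μ : ℝ) :
    dWaveSourceEnergyDensityTT' t' U μ 0 = gcEnergyDensityTT' 1 t' U μ := by
  rw [dWaveSourceEnergyDensityTT'_zero_eq_tiGroundEnergyDensity_hubbardTTPrimeMu,
    tiGroundEnergyDensity_hubbardTTPrimeMu_eq_gcEnergyDensityTT' 1 t' hU μ]

/-- `t' = 0` twin: `dWaveSourceEnergyDensity U μ 0 = gcEnergyDensityTT' 1 0 U μ` (`U ≥ 0`).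
[cite: Ruelle1969, §3.4] -/
theorem dWaveSourceEnergyDensity_zero_eq_gcEnergyDensityTT' {U : ℝ} (hU : 0 ≤ U) (μ : ℝ) :
    dWaveSourceEnergyDensity U μ 0 = gcEnergyDensityTT' 1 0 U μ := by
  rw [← dWaveSourceEnergyDensityTT'_zero_tp, dWaveSourceEnergyDensityTT'_zero_eq_gcEnergyDensityTT' 0 hU μ]

/-- **TRANSPORT, grand-canonical ⇒ canonical**: `e_src(t',U,μ,0) + μn ≤ energyDensityTT' 1 t' U n` for every
density `n ∈ [0,2)` and every `μ` (`U ≥ 0`) — the sourced torus energy density at `h = 0` is a supporting line of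
the canonical energy density. [cite: Ruelle1969, §3.4] -/
theorem dWaveSourceEnergyDensityTT'_zero_add_mul_le_energyDensityTT' (t' : ℝ) {U : ℝ} (hU : 0 ≤ U) (μ : ℝ)
    {n : ℝ} (hn0 : 0 ≤ n) (hn2 : n < 2) :
    dWaveSourceEnergyDensityTT' t' U μ 0 + μ * n ≤ energyDensityTT' 1 t' U n := by
  rw [dWaveSourceEnergyDensityTT'_zero_eq_gcEnergyDensityTT' t' hU μ]
  exact gcEnergyDensityTT'_add_mul_le 1 t' hU μ hn0 hn2

/-- **Certified form of the transport**: a certified grand-canonical torus FLOOR at `h = 0`,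
`lo·L² ≤ E₀(H_L(1,t',U) − μN_L)` for all `L ≥ L₀` (a source-free leg of a sourced menu), is a certified
CANONICAL floor `lo + μn ≤ energyDensityTT' 1 t' U n` at EVERY density `n ∈ [0,2)` (`U ≥ 0`).
[cite: Ruelle1969, §3.4] -/
theorem add_mul_le_energyDensityTT'_of_forall_groundEnergy_dWaveSourceTorusTT'_zero_ge (t' : ℝ) {U : ℝ}
    (hU : 0 ≤ U) (μ : ℝ) {lo : ℝ} {L₀ : ℕ}
    (hlo : ∀ (L : ℕ) [NeZero L], L₀ ≤ L → lo * (L : ℝ) ^ 2 ≤ (dWaveSourceTorusTT' L t' U μ 0).groundEnergy)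
    {n : ℝ} (hn0 : 0 ≤ n) (hn2 : n < 2) :
    lo + μ * n ≤ energyDensityTT' 1 t' U n := by
  have h := dWaveSourceEnergyDensityTT'_ge_of_forall_le t' U μ 0 hlo
  linarith [dWaveSourceEnergyDensityTT'_zero_add_mul_le_energyDensityTT' t' hU μ hn0 hn2]

/-- **Fenchel–Moreau for the torus object**: at every interior density `0 < n < 2` (`U ≥ 0`) some chemical
potential attains `e_src(t',U,μ,0) + μn = energyDensityTT' 1 t' U n` — the canonical energy of a material of
known filling is recovered exactly from the grand-canonical torus limits. [cite: Ruelle1969, §3.4] -/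
theorem exists_dWaveSourceEnergyDensityTT'_zero_add_mul_eq (t' : ℝ) {U : ℝ} (hU : 0 ≤ U) {n : ℝ}
    (hn0 : 0 < n) (hn2 : n < 2) :
    ∃ μ : ℝ, dWaveSourceEnergyDensityTT' t' U μ 0 + μ * n = energyDensityTT' 1 t' U n := by
  obtain ⟨μ, hμ⟩ := exists_gcEnergyDensityTT'_add_mul_eq 1 t' hU hn0 hn2
  exact ⟨μ, by rw [dWaveSourceEnergyDensityTT'_zero_eq_gcEnergyDensityTT' t' hU μ]; exact hμ⟩

/-- **TRANSPORT, canonical ⇒ grand-canonical (caps)**: a certified canonical upper row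
`energyDensityTT' 1 t' U n ≤ R` at any density `n ∈ [0,2)` caps the sourced torus energy density at EVERY
chemical potential and EVERY source, `e_src(t',U,μ,h) ≤ R − μn` (`U ≥ 0`; the source never raises the energy,
`dWaveSourceEnergyDensityTT'_le_at_zero`). [cite: Ruelle1969, §3.4] -/
theorem dWaveSourceEnergyDensityTT'_le_of_energyDensityTT'_le (t' : ℝ) {U : ℝ} (hU : 0 ≤ U) (μ h : ℝ)
    {n R : ℝ} (hn0 : 0 ≤ n) (hn2 : n < 2) (hR : energyDensityTT' 1 t' U n ≤ R) :
    dWaveSourceEnergyDensityTT' t' U μ h ≤ R - μ * n := by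
  have h0 := dWaveSourceEnergyDensityTT'_le_at_zero t' U μ h
  have h1 := dWaveSourceEnergyDensityTT'_zero_add_mul_le_energyDensityTT' t' hU μ hn0 hn2
  linarith

end Legendre

/-! ### §5 The density of grand-canonical torus-limit ground states from `μ`-secants of `e_src` -/

section Density

variable {ω : InfVolFermionState 2} {ψ : ∀ L, Fock (Orb (FermionTorus 2 L))} {Ls : ℕ → ℕ}

/-- **Density brackets in closed form** (Ruelle's `ρ ∈ −∂_μ e_GC`, at any source `h`): every torus limit
`ω` of unit ground-state vectors of `A_L(t',U,μ,h)` has, for every `δ > 0`,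
`(e_src(μ−δ,h) − e_src(μ,h))/δ ≤ ρ(ω) ≤ (e_src(μ,h) − e_src(μ+δ,h))/δ`
(`e_src(μ',h) ≤ e_Ψ(μ')(ω) = e_Ψ(μ)(ω) − (μ' − μ)ρ(ω)` and `e_Ψ(μ)(ω) = e_src(μ,h)`).
[cite: Ruelle1969, §3.4] -/
theorem InfVolFermionState.IsTorusLimitOf.density_mem_Icc_secant_dWaveSourceEnergyDensityTT'
    [hL0 : ∀ j, NeZero (Ls j)] (hω : ω.IsTorusLimitOf ψ Ls) (hLs : Tendsto Ls atTop atTop)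
    (hψ : ∀ j, star (ψ (Ls j)) ⬝ᵥ ψ (Ls j) = 1) (t' U μ h : ℝ)
    (hgs : ∀ j, dWaveSourceTorusTT' (Ls j) t' U μ h *ᵥ ψ (Ls j) =
      ((Matrix.groundEnergy (dWaveSourceTorusTT' (Ls j) t' U μ h) : ℝ) : ℂ) • ψ (Ls j))
    {δ : ℝ} (hδ : 0 < δ) :
    ω.density ∈ Set.Icc
      ((dWaveSourceEnergyDensityTT' t' U (μ - δ) h - dWaveSourceEnergyDensityTT' t' U μ h) / δ)
      ((dWaveSourceEnergyDensityTT' t' U μ h - dWaveSourceEnergyDensityTT' t' U (μ + δ) h) / δ) := by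
  have hTI := hω.isTranslationInvariant
  have h0 := hω.meanEnergy_sourced_eq_dWaveSourceEnergyDensityTT' hLs hψ t' U μ h hgs
  have h1 := dWaveSourceEnergyDensityTT'_le_meanEnergy_sourced t' U (μ - δ) h hTI
  have h2 := dWaveSourceEnergyDensityTT'_le_meanEnergy_sourced t' U (μ + δ) h hTI
  rw [InfVolFermionState.meanEnergy_hubbardTTPrimeSourced] at h0 h1 h2
  constructor
  · rw [div_le_iff₀ hδ]
    linarith
  · rw [le_div_iff₀ hδ]
    linarith

/-- **Certified form**: with certified bounds `lo₋ ≤ e_src(μ−δ,h)`, `lo₊ ≤ e_src(μ+δ,h)` (e.g. torus floors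
for all large `L`, `dWaveSourceEnergyDensityTT'_ge_of_forall_le`) and `e_src(μ,h) ≤ hi` (any certified ceiling,
e.g. a torus-limit trial state or `dWaveSourceEnergyDensityTT'_le_of_forall_le`), every torus-limit ground state
at `(μ, h)` has density in `[(lo₋ − hi)/δ, (hi − lo₊)/δ]` — the certified conversion term between a
grand-canonical sourced leg at `μ` and a statement at fixed filling. [cite: Ruelle1969, §3.4] -/
theorem InfVolFermionState.IsTorusLimitOf.density_mem_Icc_of_dWaveSourceEnergyDensityTT'_bounds
    [hL0 : ∀ j, NeZero (Ls j)] (hω : ω.IsTorusLimitOf ψ Ls) (hLs : Tendsto Ls atTop atTop)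
    (hψ : ∀ j, star (ψ (Ls j)) ⬝ᵥ ψ (Ls j) = 1) (t' U μ h : ℝ)
    (hgs : ∀ j, dWaveSourceTorusTT' (Ls j) t' U μ h *ᵥ ψ (Ls j) =
      ((Matrix.groundEnergy (dWaveSourceTorusTT' (Ls j) t' U μ h) : ℝ) : ℂ) • ψ (Ls j))
    {δ loMinus loPlus hi : ℝ} (hδ : 0 < δ)
    (hloMinus : loMinus ≤ dWaveSourceEnergyDensityTT' t' U (μ - δ) h)
    (hloPlus : loPlus ≤ dWaveSourceEnergyDensityTT' t' U (μ + δ) h)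
    (hhi : dWaveSourceEnergyDensityTT' t' U μ h ≤ hi) :
    ω.density ∈ Set.Icc ((loMinus - hi) / δ) ((hi - loPlus) / δ) := by
  obtain ⟨h1, h2⟩ := hω.density_mem_Icc_secant_dWaveSourceEnergyDensityTT' hLs hψ t' U μ h hgs hδ
  constructor
  · refine le_trans ?_ h1
    exact div_le_div_of_nonneg_right (by linarith) hδ.le
  · refine h2.trans ?_
    exact div_le_div_of_nonneg_right (by linarith) hδ.le

end Density

end Literature.MathematicalPhysics.QuantumLattice

end
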